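import Summits.KontsevichZagierPeriods.KontsevichZagierPeriods.Theorems.SoloInformedToricNondegenerate
import HarnessLib

/-!
# Cube-nondegeneracy from the linear part; the `ζ(2)` denominator `x + y − xy`

Solo programme `solo-KontsevichZagierPeriods-informed`, session s104.

A criterion for the hypothesis of THEOREM ND (`soloInformed_presentable_of_nondegenerate`) that
goes beyond positive coefficients (THEOREM TOR):

* `soloInformed_cubeNondegenerate_of_linear` — **LEMMA LIN**: if `Q(0) = 0`, every linear
  coefficient `∂Q/∂xᵢ(0)` is positive and `Q` has no zero on the punctured closed cube
  `[0,1]ⁿ ∖ {0}`, then `Q` is cube-nondegenerate.  (For a weight `w` with a zero entry the initial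
  form is `Q` restricted to the coordinate face `{xᵢ = 0 : wᵢ ≠ 0}`, evaluated at a point of the
  punctured cube; for a weight with all entries positive it is the positive linear form
  `∑_{wᵢ = min w} cᵢ xᵢ`.)
* `soloInformed_cubeNondegenerate_zeta2Denominator` — `x + y − xy` is cube-nondegenerate (it
  vanishes at the corner `0`, so THEOREM TOR does not apply), hence
* `soloInformed_presentable_zeta2Denominator` — every `IntegralRep` `[[0,1]², x^p/(x + y − xy)]` is
  presentable in the KZ calculus; for `p = 0` this is `ζ(2) = ∫∫_{[0,1]²} dx dy/(1 − xy)` after the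
  corner move `(x, y) ↦ (1 − x, 1 − y)`.

References: A. G. Kouchnirenko, Invent. Math. 32 (1976) §1; M. Kontsevich, D. Zagier, *Periods*
(2001), §1.1 (the `ζ(2)` example); J. Ayoub, EMS Newsl. 91 (2014), §2.2.
-/

noncomputable section

open scoped BigOperators
open MeasureTheory Set
open Literature.NumberTheory.Transcendental Literature.NumberTheory.Transcendental.KZ

namespace Summit.KontsevichZagierPeriods.KontsevichZagierPeriods.Theorems

variable {n : ℕ}

/-! ### Weighted degrees of small exponents -/

/-- `⟨w, a⟩ = 0` iff `a` is supported on the zero set of `w`. [this work] -/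
theorem soloInformed_wdeg_eq_zero_iff (w : Fin n → ℕ) (a : Fin n →₀ ℕ) :
    soloInformedWDeg w a = 0 ↔ ∀ i, w i = 0 ∨ a i = 0 := by
  unfold soloInformedWDeg
  rw [Finset.sum_eq_zero_iff]
  simp [mul_eq_zero]

/-- `⟨w, eᵢ⟩ = wᵢ`. [this work] -/
theorem soloInformed_wdeg_single (w : Fin n → ℕ) (i : Fin n) :
    soloInformedWDeg w (Finsupp.single i 1) = w i := by
  simp [soloInformedWDeg, Finsupp.single_apply]

/-- `(min w) · |a| ≤ ⟨w, a⟩`. [this work] -/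
theorem soloInformed_mul_sum_le_wdeg (w : Fin n → ℕ) (a : Fin n →₀ ℕ) {μ : ℕ}
    (hμ : ∀ i, μ ≤ w i) : μ * ∑ i, a i ≤ soloInformedWDeg w a := by
  unfold soloInformedWDeg
  rw [Finset.mul_sum]
  exact Finset.sum_le_sum fun i _ => Nat.mul_le_mul_right _ (hμ i)

/-- A non-zero exponent vector of total degree `≤ 1` is a unit vector. [this work] -/
theorem soloInformed_eq_single_of_sum_le_one {a : Fin n →₀ ℕ} (ha : a ≠ 0)
    (h : ∑ i, a i ≤ 1) : ∃ i, a = Finsupp.single i 1 := by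
  obtain ⟨i, hi⟩ : ∃ i, a i ≠ 0 := by
    by_contra hc
    push Not at hc
    exact ha (Finsupp.ext hc)
  refine ⟨i, Finsupp.ext fun j => ?_⟩
  have hi1 : a i ≤ 1 :=
    (Finset.single_le_sum (fun k _ => Nat.zero_le (a k)) (Finset.mem_univ i)).trans h
  by_cases hji : j = i
  · subst hji
    rw [Finsupp.single_eq_same]
    omega
  · have h2 : a i + a j ≤ ∑ k, a k := by
      rw [← Finset.sum_pair (Ne.symm hji)]
      exact Finset.sum_le_sum_of_subset (Finset.subset_univ _)
    have h3 : Finsupp.single i 1 j = 0 := by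
      rw [Finsupp.single_apply, if_neg (Ne.symm hji)]
    rw [h3]
    omega

/-- A non-zero exponent vector has positive total degree. [this work] -/
theorem soloInformed_one_le_sum_of_ne_zero {a : Fin n →₀ ℕ} (ha : a ≠ 0) : 1 ≤ ∑ i, a i := by
  obtain ⟨i, hi⟩ : ∃ i, a i ≠ 0 := by
    by_contra hc
    push Not at hc
    exact ha (Finsupp.ext hc)
  exact (Nat.one_le_iff_ne_zero.2 hi).trans
    (Finset.single_le_sum (fun k _ => Nat.zero_le (a k)) (Finset.mem_univ i))

/-! ### LEMMA LIN -/

open Classical in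
/-- **LEMMA LIN — cube-nondegeneracy from the linear part.**  Let `n ≥ 1` and
`Q ∈ ℚ[x₁, …, xₙ]` with `Q(0) = 0`, all linear coefficients `coeff_{eᵢ} Q > 0`, and no zero on the
punctured closed cube `[0,1]ⁿ ∖ {0}`.  Then `Q` is cube-nondegenerate.  Examples: `x + y − xy`,
`x + y + z − xyz`, `x + y − xy + x²y³`. [this work; cf. Kouchnirenko 1976 §1] -/
theorem soloInformed_cubeNondegenerate_of_linear (hn : 0 < n) (Q : MvPolynomial (Fin n) ℚ)
    (h0 : MvPolynomial.coeff 0 Q = 0)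
    (hlin : ∀ i, 0 < MvPolynomial.coeff (Finsupp.single i 1) Q)
    (hpos : ∀ x : Fin n → ℝ, (∀ i, 0 ≤ x i ∧ x i ≤ 1) → x ≠ 0 → MvPolynomial.aeval x Q ≠ 0) :
    SoloInformedCubeNondegenerate Q := by
  intro w y hy
  have hsupp1 : ∀ i, Finsupp.single i 1 ∈ Q.support := fun i =>
    MvPolynomial.mem_support_iff.2 (hlin i).ne'
  have h0' : ∀ a ∈ Q.support, a ≠ 0 := fun a ha h =>
    (MvPolynomial.mem_support_iff.1 ha) (by rw [h, h0])
  rw [soloInformed_aeval_initForm]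
  by_cases hw : ∃ i, w i = 0
  · -- Case A: `w` has a zero entry — the initial form is `Q` on a coordinate face
    obtain ⟨i₀, hi₀⟩ := hw
    set z : Fin n → ℝ := fun i => if w i = 0 then y i else 0 with hz
    have hzcube : ∀ i, 0 ≤ z i ∧ z i ≤ 1 := by
      intro i
      by_cases h : w i = 0
      · simp only [hz, h, if_true]; exact ⟨(hy i).1.le, (hy i).2⟩
      · simp only [hz, h, if_false]; exact ⟨le_rfl, zero_le_one⟩
    have hz0 : z ≠ 0 := fun h => (hy i₀).1.ne' (by simpa [hz, hi₀] using congr_fun h i₀)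
    have hzQ := hpos z hzcube hz0
    -- `a` is initial iff `⟨w, a⟩ = 0`
    have hinit : ∀ a ∈ Q.support, (SoloInformedIsInit w Q a ↔ soloInformedWDeg w a = 0) := by
      intro a _
      constructor
      · intro h
        have h1 := h _ (hsupp1 i₀)
        rw [soloInformed_wdeg_single, hi₀] at h1
        exact Nat.le_zero.1 h1
      · intro h b _
        rw [h]
        exact Nat.zero_le _
    -- `z^a = y^a` if `⟨w, a⟩ = 0`, else `0`
    have hza : ∀ a : Fin n →₀ ℕ, (∏ i, z i ^ a i) =
        if soloInformedWDeg w a = 0 then ∏ i, y i ^ a i else 0 := by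
      intro a
      split_ifs with h
      · rw [soloInformed_wdeg_eq_zero_iff] at h
        refine Finset.prod_congr rfl fun i _ => ?_
        rcases h i with hi | hi
        · simp only [hz, hi, if_true]
        · simp only [hi, pow_zero]
      · rw [soloInformed_wdeg_eq_zero_iff] at h
        push Not at h
        obtain ⟨i, hwi, hai⟩ := h
        exact Finset.prod_eq_zero (Finset.mem_univ i) (by simp [hz, hwi, hai])
    have hsum : (∑ a ∈ Q.support.filter (SoloInformedIsInit w Q),
        algebraMap ℚ ℝ (MvPolynomial.coeff a Q) * ∏ i, y i ^ a i) = MvPolynomial.aeval z Q := by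
      rw [soloInformed_aeval_eq_sum_support, Finset.sum_filter]
      refine Finset.sum_congr rfl fun a ha => ?_
      rw [hza a]
      by_cases h : soloInformedWDeg w a = 0
      · rw [if_pos ((hinit a ha).2 h), if_pos h]
      · rw [if_neg (fun h' => h ((hinit a ha).1 h')), if_neg h, mul_zero]
    rw [hsum]
    exact hzQ
  · -- Case B: all entries of `w` positive — the initial form is a positive linear form
    push Not at hw
    obtain ⟨i₀, -, hμ⟩ := Finset.exists_min_image Finset.univ w ⟨⟨0, hn⟩, Finset.mem_univ _⟩
    have hμ' : ∀ i, w i₀ ≤ w i := fun i => hμ i (Finset.mem_univ i)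
    have hμpos : 0 < w i₀ := Nat.pos_of_ne_zero (hw i₀)
    -- an initial exponent is a unit vector
    have hkey : ∀ a ∈ Q.support, SoloInformedIsInit w Q a → ∃ i, a = Finsupp.single i 1 := by
      intro a ha hinit
      have h1 : soloInformedWDeg w a ≤ w i₀ := by
        have := hinit _ (hsupp1 i₀)
        rwa [soloInformed_wdeg_single] at this
      have h2 : w i₀ * ∑ i, a i ≤ soloInformedWDeg w a := soloInformed_mul_sum_le_wdeg w a hμ'
      have h3 : ∑ i, a i ≤ 1 := by
        refine Nat.le_of_mul_le_mul_left (?_ : w i₀ * ∑ i, a i ≤ w i₀ * 1) hμpos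
        rw [mul_one]
        exact h2.trans h1
      exact soloInformed_eq_single_of_sum_le_one (h0' a ha) h3
    -- every initial term is positive on `(0,1]ⁿ` …
    have hterm : ∀ a ∈ Q.support.filter (SoloInformedIsInit w Q),
        0 < algebraMap ℚ ℝ (MvPolynomial.coeff a Q) * ∏ i, y i ^ a i := by
      intro a ha
      obtain ⟨ha, hinit⟩ := Finset.mem_filter.1 ha
      obtain ⟨i, rfl⟩ := hkey a ha hinit
      exact mul_pos (by rw [eq_ratCast]; exact_mod_cast hlin i)
        (Finset.prod_pos fun j _ => pow_pos (hy j).1 _)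
    -- … and `e_{i₀}` is initial
    have hi₀ : Finsupp.single i₀ 1 ∈ Q.support.filter (SoloInformedIsInit w Q) := by
      refine Finset.mem_filter.2 ⟨hsupp1 i₀, fun b hb => ?_⟩
      rw [soloInformed_wdeg_single]
      calc w i₀ = w i₀ * 1 := (mul_one _).symm
        _ ≤ w i₀ * ∑ i, b i :=
          Nat.mul_le_mul_left _ (soloInformed_one_le_sum_of_ne_zero (h0' b hb))
        _ ≤ soloInformedWDeg w b := soloInformed_mul_sum_le_wdeg w b hμ'
    exact (lt_of_lt_of_le (hterm _ hi₀)
      (Finset.single_le_sum (fun a ha => (hterm a ha).le) hi₀)).ne'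

/-! ### The `ζ(2)` denominator -/

/-- `x + y − xy` is cube-nondegenerate: `x + y − xy = x(1 − y) + y > 0` on `[0,1]² ∖ {0}`, the
linear part is `x + y`, the constant term is `0`. [this work; the example of Kontsevich–Zagier
2001 §1.1 after the corner move] -/
theorem soloInformed_cubeNondegenerate_zeta2Denominator :
    SoloInformedCubeNondegenerate
      (MvPolynomial.X 0 + MvPolynomial.X 1 - MvPolynomial.X 0 * MvPolynomial.X 1 :
        MvPolynomial (Fin 2) ℚ) := by
  refine soloInformed_cubeNondegenerate_of_linear two_pos _ ?_ ?_ ?_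
  · simp [MvPolynomial.coeff_X, MvPolynomial.coeff_X_mul']
  · intro i
    fin_cases i <;>
      simp [MvPolynomial.coeff_X, MvPolynomial.coeff_X_mul', Finsupp.single_eq_single_iff]
  · intro x hx hx0
    simp only [map_add, map_sub, map_mul, MvPolynomial.aeval_X]
    obtain ⟨i, hi⟩ := Function.ne_iff.1 hx0
    have h0 := hx 0
    have h1 := hx 1
    have key : x 0 + x 1 - x 0 * x 1 = x 0 * (1 - x 1) + x 1 := by ring
    fin_cases i
    · have hx0' : 0 < x 0 := lt_of_le_of_ne h0.1 (Ne.symm hi)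
      have : x 0 + x 1 - x 0 * x 1 = x 1 * (1 - x 0) + x 0 := by ring
      rw [this]
      exact (lt_of_lt_of_le hx0' (le_add_of_nonneg_left
        (mul_nonneg h1.1 (sub_nonneg.2 h0.2)))).ne'
    · have hx1' : 0 < x 1 := lt_of_le_of_ne h1.1 (Ne.symm hi)
      rw [key]
      exact (lt_of_lt_of_le hx1' (le_add_of_nonneg_left
        (mul_nonneg h0.1 (sub_nonneg.2 h1.2)))).ne'

/-- **Presentation of `[[0,1]², x^p/(x + y − xy)]`** — in particular of
`ζ(2) = ∫∫_{[0,1]²} dx dy/(x + y − xy)` — by cube integrals of germs holomorphic near the closed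
cube, via THEOREM ND (THEOREM TOR does not apply: the denominator vanishes at the corner).
[this work] -/
theorem soloInformed_presentable_zeta2Denominator (p : Fin 2 → ℕ) (r : IntegralRep 2)
    (hr : r.domain = soloInformedCube 2)
    (hri : EqOn r.integrand (fun x => (∏ j, x j ^ p j) / (x 0 + x 1 - x 0 * x 1))
      (soloInformedOpenCube 2)) :
    of r ∈ soloInformedPresentable :=
  soloInformed_presentable_of_nondegenerate p _ soloInformed_cubeNondegenerate_zeta2Denominator
    r hr fun x hx => by
      rw [hri hx]
      simp only [map_add, map_sub, map_mul, MvPolynomial.aeval_X]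

end Summit.KontsevichZagierPeriods.KontsevichZagierPeriods.Theorems
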